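import Summits.QuantumAdvantage.QuantumAdvantage.Theorems.SosSandwichTransferPBWalkReplayDefs
import Literature.Computability.Complexity.OracleReplay
import HarnessLib

/-!
# Crux `TransferPB` (stmt-QuantumAdvantage-15238, route SosSandwich), line `birth` — the reference machine's step function IS the plain replay

For the replay functions of `Theorems/SosSandwichTransferPBWalkReplayDefs.lean` and the reference machine
`walkMachine` (`Theorems/SosSandwichTransferPBWalkMachineDefs.lean`):

* `replay_askG`, `replay_askA`, `replay_filterComp`, `replay_flatMapComp`, `replay_forEach_askG` — replay laws of
  the building blocks (from `OracleComp.replay_bind`, `OracleReplay.lean`);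
* `replay_liveComp`, `replay_candsComp`, `replay_walkComp`, `replay_meansComp` — the replays of the machine's phases;
* **`step_walkMachine`** — `(walkMachine Wf Df).step x as = machineStepR Wf Df x as` for every input and every
  answer list: the programming fact (P') of `Theorems/SosSandwichTransferPBWalkMachineFinal.lean` is now literally
  "the first-order recursive function `machineStepR (pw∘length) (pd∘length)` is polynomial-time on the pair code"
  (`OracleAlg.IsPolyTime` unfolds to `PolyTimeComputable` of the step function).

All proved; no named fact. Sources: S. Arora, B. Barak, Computational Complexity (CUP 2009), §3.4 Def. 3.4;
S. Aaronson, A. Ambainis, Theory Comput. 10 (2014), proof of Thm. 23 (p. 14).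
-/

-- D-0017: single-conjunct summit ⇒ the duplicate `QuantumAdvantage.QuantumAdvantage` is mandated.
set_option linter.dupNamespace false

noncomputable section

namespace Summit.QuantumAdvantage.QuantumAdvantage.Cruxes.TransferPB.Birth

open Finset Literature.Computability.Cryptography Literature.Computability.Complexity
  Literature.Computability.QuantumComplexity Literature.Computability.QuantumComplexity.ClassicalSimulation

namespace SimTreePB


section ReplayLemmas

open OracleComp

variable {α β : Type}

/-- Replay of `askG`. [folklore] -/
theorem replay_askG (v : List Bool) (as : List (List Bool)) : replay (askG v) as = askR (true :: v) as := by
  cases as with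
  | nil => rfl
  | cons a as => simp [askG, OracleComp.ask, askR, replay_bind]

/-- Replay of `askA`. [folklore] -/
theorem replay_askA (u : List Bool) (as : List (List Bool)) : replay (askA u) as = askR (false :: u) as := by
  cases as with
  | nil => rfl
  | cons a as => simp [askA, OracleComp.ask, askR, replay_bind]

/-- Replay of `filterComp`. [folklore] -/
theorem replay_filterComp {p : α → OracleComp Bool} {pR : α → List (List Bool) → List Bool ⊕ (Bool × List (List Bool))}
    (hp : ∀ a as, replay (p a) as = pR a as) :
    ∀ (l : List α) (as : List (List Bool)), replay (filterComp p l) as = filterR pR l as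
  | [], as => by simp [filterComp, filterR]
  | a :: l, as => by
    simp only [filterComp, filterR, replay_bind, hp]
    rcases pR a as with q | ⟨b, as'⟩
    · rfl
    · simp only [replay_filterComp hp l as']
      rcases filterR pR l as' with q | ⟨l', as''⟩
      · rfl
      · simp

/-- Replay of `flatMapComp`. [folklore] -/
theorem replay_flatMapComp {f : α → OracleComp (List β)}
    {fR : α → List (List Bool) → List Bool ⊕ (List β × List (List Bool))} (hf : ∀ a as, replay (f a) as = fR a as) :
    ∀ (l : List α) (as : List (List Bool)), replay (flatMapComp f l) as = flatMapR fR l as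
  | [], as => by simp [flatMapComp, flatMapR]
  | a :: l, as => by
    simp only [flatMapComp, flatMapR, replay_bind, hf]
    rcases fR a as with q | ⟨m, as'⟩
    · rfl
    · simp only [replay_flatMapComp hf l as']
      rcases flatMapR fR l as' with q | ⟨m', as''⟩
      · rfl
      · simp

/-- Replay of a `forEach` of `askG`s. [folklore] -/
theorem replay_forEach_askG (g : α → List Bool) :
    ∀ (l : List α) (as : List (List Bool)), replay (OracleComp.forEach (fun a => askG (g a)) l) as = forEachAskR (fun a => true :: g a) l as
  | [], as => by simp [OracleComp.forEach, forEachAskR]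
  | a :: l, as => by
    simp only [OracleComp.forEach, forEachAskR, replay_bind, replay_askG]
    rcases askR (true :: g a) as with q | ⟨b, as'⟩
    · rfl
    · simp only [replay_forEach_askG g l as']
      rcases forEachAskR (fun a => true :: g a) l as' with q | ⟨bs, as''⟩
      · rfl
      · simp

variable (x : List Bool)

/-- **Replay of the level computation.** [folklore] -/
theorem replay_liveComp (π : List (List Bool × Bool)) :
    ∀ (j : ℕ) (as : List (List Bool)), replay (liveComp x π j) as = liveR x π j as
  | 0, as => by
    simp only [liveComp, liveR, replay_bind, replay_askG]
    rcases askR (true :: encBlockS x π []) as with q | ⟨b, as'⟩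
    · rfl
    · simp
  | j + 1, as => by
    simp only [liveComp, liveR, replay_bind, replay_liveComp π j as]
    rcases liveR x π j as with q | ⟨L, as'⟩
    · rfl
    · simp only
      exact replay_flatMapComp (fun u bs => replay_filterComp (fun v cs => replay_askG _ cs) _ bs) L as'

/-- **Replay of the candidate computation.** [folklore] -/
theorem replay_candsComp (π : List (List Bool × Bool)) (W : ℕ) (as : List (List Bool)) :
    replay (candsComp x π W) as = candsR x π W as := by
  simp only [candsComp, candsR, replay_bind, replay_flatMapComp (fun j bs => replay_liveComp x π j bs)]
  rcases flatMapR (liveR x π) (List.range W) as with q | ⟨all, as'⟩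
  · rfl
  · simp only
    refine replay_filterComp (fun u bs => ?_) all as'
    simp only [replay_bind, replay_askG]
    rcases askR (true :: encSingleS x π u) bs with q | ⟨b, bs'⟩
    · rfl
    · simp

/-- **Replay of the walk.** [folklore] -/
theorem replay_walkComp (W : ℕ) :
    ∀ (D : ℕ) (π : List (List Bool × Bool)) (as : List (List Bool)), replay (walkComp x W D π) as = walkR x W D π as
  | 0, π, as => by simp [walkComp, walkR]
  | D + 1, π, as => by
    simp only [walkComp, walkR, replay_bind, replay_candsComp]
    rcases candsR x π W as with q | ⟨c, as'⟩
    · rfl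
    · simp only
      rcases c.argmin strNum with _ | u
      · simp
      · simp only [replay_bind, replay_askA]
        rcases askR (false :: u) as' with q | ⟨b, as''⟩
        · rfl
        · simp only
          exact replay_walkComp W D _ _

/-- **Replay of the MEAN block.** [folklore] -/
theorem replay_meansComp (π : List (List Bool × Bool)) (as : List (List Bool)) :
    replay (meansComp x π) as = meansR x π as :=
  replay_forEach_askG (fun j => encMeanS x π j) _ as

/-- **The step function of the reference machine is the plain replay `machineStepR`.** This is the specification
an `FP` implementation is verified against (`(walkMachine Wf Df).IsPolyTime` ⟸ `machineStepR Wf Df` on the pair code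
is polynomial-time). [folklore] -/
theorem step_walkMachine (Wf Df : List Bool → ℕ) (x : List Bool) (as : List (List Bool)) :
    (walkMachine Wf Df).step x as = machineStepR Wf Df x as := by
  show toStep (machineComp Wf Df x) as = _
  rw [toStep_eq_replay]
  simp only [machineComp, machineStepR, replay_bind, replay_walkComp]
  rcases walkR x (Wf x) (Df x) [] as with q | ⟨π, as'⟩
  · rfl
  · simp only [replay_meansComp]
    rcases meansR x π as' with q | ⟨bs, as''⟩
    · rfl
    · simp

end ReplayLemmas

end SimTreePB

end Summit.QuantumAdvantage.QuantumAdvantage.Cruxes.TransferPB.Birth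

end
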